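import Literature.AlgebraicGeometry.Milne1999.MumfordTateGroupProductsPowers
import HarnessLib

/-!
# The restriction homomorphism `MT(X × Y) → MT(X) × MT(Y)`: `MT(X × Y)(ℂ) ≤ MT(X)(ℂ) × MT(Y)(ℂ)` block-diagonally for arbitrary `X`, `Y`, with `Hg ↦ Hg × Hg` and `w ↦ (w, w)`; `MT(⨁ᵢ Aᵢ) ↪ ∏ᵢ MT(Aᵢ)` and `MT(X) ↪ ∏ᵢ MT(Aᵢ)` for `X ∼ ⨁ᵢ Aᵢ^{rᵢ+1}` (Gordon 1999 2.2–2.3 «`MT = 𝔾_m · Hg`» with Moonen–Zarhin 1999 (3.1), Tannaka-free, on the real carriers)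

Family `hodge`, layer `Literature/AlgebraicGeometry/Milne1999`, namespace `Literature.AlgebraicGeometry.Milne1999` (D-0022).
THEOREMS ONLY (no definition, no named fact, no `sorry`; net debt 0). Sequel of `Milne1999/MumfordTateGroupProductsPowers` (p21 g35-#7:
`MT|_{H¹} = ℂˣ · Hg|_{H¹}` on products of powers) and the Mumford–Tate companion of `Milne1999/HodgeGroupProductsRestriction` (g35-#9)
and `Milne1999/LefschetzGroupProductsRestriction` (g35-#2), written by the `lit-hodgefound` prover seat p21 (generation 35, row #10).

## Sources, verbatim

* B. B. Gordon, *A survey of the Hodge conjecture for abelian varieties* (1999), 2.2 «`MT(A) := MT(H¹(A, ℚ))`», 2.3 (iii) «`MT(V) = 𝔾_m · Hg(V)`»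
  (the tree's `mem_map_mumfordTateGroup_one_iff`: `MT(X)(ℂ)|_{H¹} = ℂˣ · Hg(X)(ℂ)|_{H¹}`).
* B. Moonen, Yu. G. Zarhin, Math. Ann. 315 (1999) [held: `paper:arxiv-math_9901113`, chunk p0006 L24–L28], §3 (3.1): «`Hg(X)` is an algebraic
  subgroup of `Hg(X_1) × Hg(X_2)`» (`X = X_1 × X_2`).
* J. S. Milne, Duke Math. J. 96 (1999), §1 p. 643: «`C(A) ⊂ C(A_1) × ⋯ × C(A_s)`».

## Dictionary (all objects pre-existing; nothing is defined here)

`MT(Y)(ℂ) = HodgeTheory.mumfordTateGroup (dim Y) Y.X`, `MT(Y)(ℂ)|_{H¹} = (mumfordTateGroup …).map (evaluation at 1)`, `Hg(Y)(ℂ) = HodgeTheory.hodgeGroup`,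
`Hg|_{H¹} = VanGeemen1994.hodgeGroupOne`, `w(c) = weightCocharacter Y.X c`; `s ⊕ t = prodBlockDiagEquiv s t`; `⨁ A`, `Y^{r+1} = Y.powSucc r`.

## What is proved

* §1 **`MT(X × Y)(ℂ)|_{H¹} ⊆ {u ⊕ v | u ∈ MT(X)|_{H¹}, v ∈ MT(Y)|_{H¹}}`** (`exists_eq_prodBlockDiagEquiv_of_mem_map_mumfordTateGroup_one_prod`):
  `m₁ = c · (u' ⊕ v') = (c u') ⊕ (c v')` with Hodge blocks `u'`, `v'`.
* §2 **THE RESTRICTION HOMOMORPHISM `ρ : MT(X × Y)(ℂ) → MT(X)(ℂ) × MT(Y)(ℂ)`** for ARBITRARY `X`, `Y` (`exists_mumfordTateGroup_prod_restrictHom`: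
  `m₁ = ρ(m)₁,₁ ⊕ ρ(m)₂,₁`), unique, INJECTIVE, `ρ(w(c)) = (w(c), w(c))`, and `ρ` carries `Hg(X × Y)` into `Hg(X) × Hg(Y)`.
* §3 **EVERY NUMBER OF FACTORS**: `MT(⨁ᵢ Aᵢ)(ℂ) ↪ ∏ᵢ MT(Aᵢ)(ℂ)` (`exists_mumfordTateGroup_biproduct_restrictHom`), `MT(X)(ℂ) ↪ ∏ᵢ MT(Aᵢ)(ℂ)` for
  `X ∼ ⨁ᵢ Aᵢ^{rᵢ+1}` (`exists_mumfordTateGroup_restrictHom_of_isIsogenous_biproduct_powSucc`), and commutativity descends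
  (`forall_mul_comm_mumfordTateGroup_of_forall_of_isIsogenous_biproduct_powSucc`).

## What is NOT here (honest column)

Surjectivity of the projections `MT(X × Y) → MT(X)` (not available on the Tannaka-free carriers); the image of `ρ` (for `MT` the common
scalar is only determined up to `Hg ∩ 𝔾_m`); algebraic groups over `ℚ`. PRESEARCH (2026-08-28): tree `rg 'mumfordTateGroup.*restrict|restrictHom' Literature/AlgebraicGeometry/Milne1999`
finds only the `L` / `Hg` restriction files of this seat; certification on the carriers, no novelty claimed.

## References

* [Gordon1999HodgeAVSurvey] B. B. Gordon, A survey of the Hodge conjecture for abelian varieties (1999): 2.2, 2.3 (iii).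
* [MoonenZarhin1999LowDim] B. Moonen, Yu. G. Zarhin, Hodge classes on abelian varieties of low dimension, Math. Ann. 315 (1999): §1, §3 (3.1).
* [Milne1999LefschetzClasses] J. S. Milne, Lefschetz classes on abelian varieties, Duke Math. J. 96 (1999): §1 p. 643.
* [Deligne1982HodgeCycles] P. Deligne (notes by J. S. Milne), LNM 900 (1982): I Prop. 3.4, 3.6.
-/

noncomputable section

open CategoryTheory CategoryTheory.Limits
open Literature.AlgebraicTopology.SingularHomology
open Literature.AlgebraicGeometry.HodgeTheory
open Literature.AlgebraicGeometry.Motives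
open Literature.AlgebraicGeometry.VanGeemen1994 (hodgeGroupOne mem_hodgeGroupOne_iff)

namespace Literature.AlgebraicGeometry.Milne1999

/-! ### §0 Plumbing (private) -/

section Plumbing

/-- `s ⊕ t` determines `s` and `t`. [cite: Milne1999LefschetzClasses, §1 p. 643 (V(A₁ × A₂) = V(A₁) ⊕ V(A₂))] -/
private theorem prodBlockDiagEquiv_inj {X Y : AbelianVariety ℂ} {s s' : complexBetti X.X 1 ≃ₗ[ℂ] complexBetti X.X 1}
    {t t' : complexBetti Y.X 1 ≃ₗ[ℂ] complexBetti Y.X 1} (h : prodBlockDiagEquiv s t = prodBlockDiagEquiv s' t') :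
    s = s' ∧ t = t' := by
  have e := congrArg LinearEquiv.toLinearMap h
  rw [coe_prodBlockDiagEquiv, coe_prodBlockDiagEquiv] at e
  refine ⟨LinearEquiv.toLinearMap_injective ?_, LinearEquiv.toLinearMap_injective ?_⟩
  · rw [← prodRestrictFst_prodBlockDiag s.toLinearMap t.toLinearMap, e, prodRestrictFst_prodBlockDiag]
  · rw [← prodRestrictSnd_prodBlockDiag s.toLinearMap t.toLinearMap, e, prodRestrictSnd_prodBlockDiag]

/-- `c · (u ⊕ v) = (c u) ⊕ (c v)`. [cite: Milne1999LefschetzClasses, §1 p. 643] -/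
private theorem smulOfUnit_mul_prodBlockDiagEquiv {B C : AbelianVariety ℂ} (c : ℂˣ)
    (u : complexBetti B.X 1 ≃ₗ[ℂ] complexBetti B.X 1) (v : complexBetti C.X 1 ≃ₗ[ℂ] complexBetti C.X 1) :
    LinearEquiv.smulOfUnit c * prodBlockDiagEquiv u v =
      prodBlockDiagEquiv (LinearEquiv.smulOfUnit c * u) (LinearEquiv.smulOfUnit c * v) := by
  rw [prodBlockDiagEquiv_mul, prodBlockDiagEquiv_smulOfUnit]

/-- `MT(A)(ℂ)|_{H¹} ≤ (C(A) ⊗ ℂ)^×` (`MT|_{H¹} = ℂˣ · Hg|_{H¹}`, scalars central, `Hg|_{H¹} ≤ C`). [cite: Deligne1982HodgeCycles, I Prop. 3.4] -/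
private theorem apply_one_mem_centralizerGroup_of_mem_mumfordTateGroup {A : AbelianVariety ℂ}
    {g : ∀ k : ℕ, complexBetti A.X k ≃ₗ[ℂ] complexBetti A.X k} (hg : g ∈ mumfordTateGroup A.dim A.X) :
    g 1 ∈ centralizerGroup A := by
  obtain ⟨c, u', hu', e⟩ := mem_map_mumfordTateGroup_one_iff.1 ⟨g, hg, rfl⟩
  rw [show g 1 = LinearEquiv.smulOfUnit c * u' from e]
  refine mul_mem (fun φ x ↦ ?_) (hodgeGroupOne_le_centralizerGroup hu')
  simp [LinearEquiv.smulOfUnit, Units.smul_def, map_smul]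

/-- `w(c)₁ = c` on `H¹`. [folklore] -/
private theorem weightCocharacter_one_eq_smulOfUnit (Z : AbelianVariety ℂ) (c : ℂˣ) :
    weightCocharacter Z.X c 1 = LinearEquiv.smulOfUnit c := by
  rw [show weightCocharacter Z.X c 1 = LinearEquiv.smulOfUnit (c ^ 1) from rfl, pow_one]

/-- For `m ∈ MT(Z)(ℂ)`: `m ∈ Hg(Z)(ℂ)` iff `m₁ ∈ Hg(Z)(ℂ)|_{H¹}`. [cite: Deligne1982HodgeCycles, I §3] -/
private theorem mem_hodgeGroup_iff_apply_one_mem {Z : AbelianVariety ℂ} {g : ∀ k : ℕ, complexBetti Z.X k ≃ₗ[ℂ] complexBetti Z.X k}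
    (hg : g ∈ mumfordTateGroup Z.dim Z.X) : g ∈ hodgeGroup Z.dim Z.X ↔ g 1 ∈ hodgeGroupOne Z.dim Z.X := by
  refine ⟨fun h ↦ mem_hodgeGroupOne_iff.2 ⟨g, h, rfl⟩, fun h ↦ ?_⟩
  obtain ⟨s, hs, hs1⟩ := mem_hodgeGroupOne_iff.1 h
  have e : s = g := mumfordTateGroup_ext_one (hodgeGroup_le_mumfordTateGroup hs) hg hs1
  exact e ▸ hs

end Plumbing

/-! ### §1 `MT(X × Y)(ℂ)|_{H¹} ⊆ {u ⊕ v | u ∈ MT(X)|_{H¹}, v ∈ MT(Y)|_{H¹}}` -/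

section One

variable (X Y : AbelianVariety ℂ)

/-- **On `H¹`: `MT(X × Y)(ℂ)|_{H¹} ⊆ {u ⊕ v | u ∈ MT(X)(ℂ)|_{H¹}, v ∈ MT(Y)(ℂ)|_{H¹}}`** for ARBITRARY `X`, `Y`: `m₁ = c · (u' ⊕ v') = (c u') ⊕ (c v')`
with `u' ⊕ v' ∈ Hg(X × Y)|_{H¹}` block diagonal with Hodge blocks (the lane's `exists_eq_prodBlockDiagEquiv_of_mem_hodgeGroupOne_prod`).
[cite: Gordon1999HodgeAVSurvey, 2.2 and 2.3 (iii)] [cite: MoonenZarhin1999LowDim, §3 (3.1)] -/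
theorem exists_eq_prodBlockDiagEquiv_of_mem_map_mumfordTateGroup_one_prod {U : complexBetti (X.prod Y).X 1 ≃ₗ[ℂ] complexBetti (X.prod Y).X 1}
    (hU : U ∈ (mumfordTateGroup (X.prod Y).dim (X.prod Y).X).map
      (Pi.evalMonoidHom (fun k : ℕ ↦ complexBetti (X.prod Y).X k ≃ₗ[ℂ] complexBetti (X.prod Y).X k) 1)) :
    ∃ u ∈ (mumfordTateGroup X.dim X.X).map (Pi.evalMonoidHom (fun k : ℕ ↦ complexBetti X.X k ≃ₗ[ℂ] complexBetti X.X k) 1),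
      ∃ v ∈ (mumfordTateGroup Y.dim Y.X).map (Pi.evalMonoidHom (fun k : ℕ ↦ complexBetti Y.X k ≃ₗ[ℂ] complexBetti Y.X k) 1),
        U = prodBlockDiagEquiv u v := by
  obtain ⟨c, U', hU', rfl⟩ := mem_map_mumfordTateGroup_one_iff.1 hU
  obtain ⟨u', hu', v', hv', rfl⟩ := exists_eq_prodBlockDiagEquiv_of_mem_hodgeGroupOne_prod X Y hU'
  exact ⟨_, mem_map_mumfordTateGroup_one_iff.2 ⟨c, u', hu', rfl⟩, _, mem_map_mumfordTateGroup_one_iff.2 ⟨c, v', hv', rfl⟩,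
    smulOfUnit_mul_prodBlockDiagEquiv c u' v'⟩

end One

/-! ### §2 The restriction homomorphism `ρ : MT(X × Y)(ℂ) → MT(X)(ℂ) × MT(Y)(ℂ)` -/

section Two

variable (X Y : AbelianVariety ℂ)

/-- **THE RESTRICTION HOMOMORPHISM `ρ : MT(X × Y)(ℂ) → MT(X)(ℂ) × MT(Y)(ℂ)`, FOR ARBITRARY `X`, `Y`**: a group homomorphism with
`m₁ = ρ(m)₁,₁ ⊕ ρ(m)₂,₁` on `H¹(X × Y) = H¹(X) ⊕ H¹(Y)` (§1 for the blocks, `MT(Z) ≅ MT(Z)|_{H¹}` to lift them to families).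
[cite: Gordon1999HodgeAVSurvey, 2.2 and 2.3 (iii)] [cite: MoonenZarhin1999LowDim, §3 (3.1)] [cite: Milne1999LefschetzClasses, §1 p. 643] -/
theorem exists_mumfordTateGroup_prod_restrictHom :
    ∃ ρ : mumfordTateGroup (X.prod Y).dim (X.prod Y).X →* mumfordTateGroup X.dim X.X × mumfordTateGroup Y.dim Y.X,
      ∀ g : mumfordTateGroup (X.prod Y).dim (X.prod Y).X, g.1 1 = prodBlockDiagEquiv ((ρ g).1.1 1) ((ρ g).2.1 1) := by
  classical
  let ι : mumfordTateGroup (X.prod Y).dim (X.prod Y).X →* centralizerGroup (X.prod Y) :=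
    ((Pi.evalMonoidHom (fun k : ℕ ↦ complexBetti (X.prod Y).X k ≃ₗ[ℂ] complexBetti (X.prod Y).X k) 1).comp
      (mumfordTateGroup (X.prod Y).dim (X.prod Y).X).subtype).codRestrict (centralizerGroup (X.prod Y))
        fun g ↦ apply_one_mem_centralizerGroup_of_mem_mumfordTateGroup g.2
  have hι : ∀ g : mumfordTateGroup (X.prod Y).dim (X.prod Y).X,
      ((ι g : centralizerGroup (X.prod Y)) : complexBetti (X.prod Y).X 1 ≃ₗ[ℂ] complexBetti (X.prod Y).X 1) = g.1 1 := fun _ ↦ rfl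
  let rX : mumfordTateGroup (X.prod Y).dim (X.prod Y).X →* (complexBetti X.X 1 ≃ₗ[ℂ] complexBetti X.X 1) :=
    (centralizerGroup.restrictFstHom X Y).comp ι
  let rY : mumfordTateGroup (X.prod Y).dim (X.prod Y).X →* (complexBetti Y.X 1 ≃ₗ[ℂ] complexBetti Y.X 1) :=
    (centralizerGroup.restrictSndHom X Y).comp ι
  have hblock : ∀ g : mumfordTateGroup (X.prod Y).dim (X.prod Y).X,
      rX g ∈ (mumfordTateGroup X.dim X.X).map (Pi.evalMonoidHom (fun k : ℕ ↦ complexBetti X.X k ≃ₗ[ℂ] complexBetti X.X k) 1) ∧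
      rY g ∈ (mumfordTateGroup Y.dim Y.X).map (Pi.evalMonoidHom (fun k : ℕ ↦ complexBetti Y.X k ≃ₗ[ℂ] complexBetti Y.X k) 1) ∧
      g.1 1 = prodBlockDiagEquiv (rX g) (rY g) := fun g ↦ by
    obtain ⟨s, hs, t, ht, hst⟩ := exists_eq_prodBlockDiagEquiv_of_mem_map_mumfordTateGroup_one_prod X Y ⟨g.1, g.2, rfl⟩
    have hmem : prodBlockDiagEquiv s t ∈ centralizerGroup (X.prod Y) := by rw [← hst]; exact (ι g).2
    have hιg : ι g = ⟨prodBlockDiagEquiv s t, hmem⟩ := Subtype.ext (by rw [hι]; exact hst)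
    have e1 : rX g = s := by
      show centralizerGroup.restrictFstHom X Y (ι g) = s
      rw [hιg, centralizerGroup.restrictFstHom_prodBlockDiagEquiv]
    have e2 : rY g = t := by
      show centralizerGroup.restrictSndHom X Y (ι g) = t
      rw [hιg, centralizerGroup.restrictSndHom_prodBlockDiagEquiv]
    rw [e1, e2]
    exact ⟨hs, ht, hst⟩
  let LX := MulEquiv.ofBijective _ (bijective_evalOne_subgroupMap_mumfordTateGroup X)
  let LY := MulEquiv.ofBijective _ (bijective_evalOne_subgroupMap_mumfordTateGroup Y)
  let ρX : mumfordTateGroup (X.prod Y).dim (X.prod Y).X →* mumfordTateGroup X.dim X.X :=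
    LX.symm.toMonoidHom.comp (rX.codRestrict _ fun g ↦ (hblock g).1)
  let ρY : mumfordTateGroup (X.prod Y).dim (X.prod Y).X →* mumfordTateGroup Y.dim Y.X :=
    LY.symm.toMonoidHom.comp (rY.codRestrict _ fun g ↦ (hblock g).2.1)
  have kX : ∀ g, (ρX g).1 1 = rX g := fun g ↦
    congrArg Subtype.val (LX.apply_symm_apply ⟨rX g, (hblock g).1⟩)
  have kY : ∀ g, (ρY g).1 1 = rY g := fun g ↦
    congrArg Subtype.val (LY.apply_symm_apply ⟨rY g, (hblock g).2.1⟩)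
  refine ⟨ρX.prod ρY, fun g ↦ ?_⟩
  show g.1 1 = prodBlockDiagEquiv ((ρX g).1 1) ((ρY g).1 1)
  rw [kX, kY]
  exact (hblock g).2.2

variable {X Y} {ρ ρ' : mumfordTateGroup (X.prod Y).dim (X.prod Y).X →* mumfordTateGroup X.dim X.X × mumfordTateGroup Y.dim Y.X}

/-- **Uniqueness** of `ρ` with `m₁ = ρ(m)₁,₁ ⊕ ρ(m)₂,₁`. [cite: Gordon1999HodgeAVSurvey, 2.2] [cite: Deligne1982HodgeCycles, I §3] -/
theorem mumfordTateGroup_prod_restrictHom_unique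
    (hρ : ∀ g : mumfordTateGroup (X.prod Y).dim (X.prod Y).X, g.1 1 = prodBlockDiagEquiv ((ρ g).1.1 1) ((ρ g).2.1 1))
    (hρ' : ∀ g : mumfordTateGroup (X.prod Y).dim (X.prod Y).X, g.1 1 = prodBlockDiagEquiv ((ρ' g).1.1 1) ((ρ' g).2.1 1)) :
    ρ = ρ' := by
  refine MonoidHom.ext fun g ↦ ?_
  obtain ⟨e1, e2⟩ := prodBlockDiagEquiv_inj ((hρ g).symm.trans (hρ' g))
  exact Prod.ext (Subtype.ext (mumfordTateGroup_ext_one (ρ g).1.2 (ρ' g).1.2 e1))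
    (Subtype.ext (mumfordTateGroup_ext_one (ρ g).2.2 (ρ' g).2.2 e2))

/-- **`MT(X × Y)(ℂ) ≤ MT(X)(ℂ) × MT(Y)(ℂ)`: the restriction homomorphism is INJECTIVE.** [cite: Gordon1999HodgeAVSurvey, 2.2 and 2.3 (iii)]
[cite: MoonenZarhin1999LowDim, §3 (3.1)] -/
theorem mumfordTateGroup_prod_restrictHom_injective
    (hρ : ∀ g : mumfordTateGroup (X.prod Y).dim (X.prod Y).X, g.1 1 = prodBlockDiagEquiv ((ρ g).1.1 1) ((ρ g).2.1 1)) :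
    Function.Injective ρ := fun g g' h ↦ by
  refine Subtype.ext (mumfordTateGroup_ext_one g.2 g'.2 ?_)
  rw [hρ g, hρ g', h]

/-- **`ρ(w(c)) = (w(c), w(c))`** (`c · 1 ⊕ c · 1 = c · 1` on `H¹`). [cite: Gordon1999HodgeAVSurvey, 2.3 (iii)] -/
theorem mumfordTateGroup_prod_restrictHom_weightCocharacter
    (hρ : ∀ g : mumfordTateGroup (X.prod Y).dim (X.prod Y).X, g.1 1 = prodBlockDiagEquiv ((ρ g).1.1 1) ((ρ g).2.1 1)) (c : ℂˣ) :
    ρ ⟨weightCocharacter (X.prod Y).X c, weightCocharacter_mem_mumfordTateGroup c⟩ =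
      (⟨weightCocharacter X.X c, weightCocharacter_mem_mumfordTateGroup c⟩, ⟨weightCocharacter Y.X c, weightCocharacter_mem_mumfordTateGroup c⟩) := by
  have key := hρ ⟨weightCocharacter (X.prod Y).X c, weightCocharacter_mem_mumfordTateGroup c⟩
  rw [show (⟨weightCocharacter (X.prod Y).X c, weightCocharacter_mem_mumfordTateGroup c⟩ :
      mumfordTateGroup (X.prod Y).dim (X.prod Y).X).1 1 = prodBlockDiagEquiv (weightCocharacter X.X c 1) (weightCocharacter Y.X c 1) by
    show weightCocharacter (X.prod Y).X c 1 = _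
    rw [weightCocharacter_one_eq_smulOfUnit, weightCocharacter_one_eq_smulOfUnit, weightCocharacter_one_eq_smulOfUnit,
      prodBlockDiagEquiv_smulOfUnit]] at key
  obtain ⟨e1, e2⟩ := prodBlockDiagEquiv_inj key
  exact Prod.ext (Subtype.ext (mumfordTateGroup_ext_one (ρ _).1.2 (weightCocharacter_mem_mumfordTateGroup c) e1.symm))
    (Subtype.ext (mumfordTateGroup_ext_one (ρ _).2.2 (weightCocharacter_mem_mumfordTateGroup c) e2.symm))

/-- **`ρ` carries `Hg(X × Y)` into `Hg(X) × Hg(Y)`** (the blocks of an element of `Hg(X × Y)|_{H¹}` are Hodge blocks).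
[cite: MoonenZarhin1999LowDim, §3 (3.1)] -/
theorem mumfordTateGroup_prod_restrictHom_mem_hodgeGroup
    (hρ : ∀ g : mumfordTateGroup (X.prod Y).dim (X.prod Y).X, g.1 1 = prodBlockDiagEquiv ((ρ g).1.1 1) ((ρ g).2.1 1))
    {g : mumfordTateGroup (X.prod Y).dim (X.prod Y).X} (hg : g.1 ∈ hodgeGroup (X.prod Y).dim (X.prod Y).X) :
    (ρ g).1.1 ∈ hodgeGroup X.dim X.X ∧ (ρ g).2.1 ∈ hodgeGroup Y.dim Y.X := by
  obtain ⟨u, hu, v, hv, e⟩ := exists_eq_prodBlockDiagEquiv_of_mem_hodgeGroupOne_prod X Y (mem_hodgeGroupOne_iff.2 ⟨g.1, hg, rfl⟩)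
  rw [hρ g] at e
  obtain ⟨e1, e2⟩ := prodBlockDiagEquiv_inj e
  exact ⟨(mem_hodgeGroup_iff_apply_one_mem (ρ g).1.2).2 (e1 ▸ hu), (mem_hodgeGroup_iff_apply_one_mem (ρ g).2.2).2 (e2 ▸ hv)⟩

end Two

/-! ### §3 Every number of factors: `MT(⨁ᵢ Aᵢ)(ℂ) ↪ ∏ᵢ MT(Aᵢ)(ℂ)`, and `MT(X)(ℂ) ↪ ∏ᵢ MT(Aᵢ)(ℂ)` for `X ∼ ⨁ᵢ Aᵢ^{rᵢ+1}` -/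

section Finite

/-- **`MT(⨁ᵢ Aᵢ)(ℂ) ↪ ∏ᵢ MT(Aᵢ)(ℂ)` FOR EVERY FINITE FAMILY** (no hypothesis on the factors): induction on the number of factors over
`⨁ A ∼ A₀ × ⨁_{i≥1} Aᵢ` (isogeny invariance of `MT`), the two-factor restriction of §2 and the induction hypothesis.
[cite: Gordon1999HodgeAVSurvey, 2.1.7 and 2.2] [cite: MoonenZarhin1999LowDim, §3 (3.1)] -/
theorem exists_mumfordTateGroup_biproduct_restrictHom :
    ∀ {n : ℕ} (A : Fin (n + 1) → AbelianVariety ℂ),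
      ∃ ρ : mumfordTateGroup (⨁ A).dim (⨁ A).X →* ∀ i, mumfordTateGroup (A i).dim (A i).X, Function.Injective ρ
  | 0, A => by
    obtain ⟨e⟩ := nonempty_mumfordTateGroup_mulEquiv_of_isIsogenous
      (⟨_, isIsogeny_biproduct_π_fin_one A⟩ : AbelianVariety.IsIsogenous (⨁ A) (A 0))
    let c : ∀ i : Fin 1, mumfordTateGroup (⨁ A).dim (⨁ A).X →* mumfordTateGroup (A i).dim (A i).X := fun i ↦
      Fin.cases (motive := fun i ↦ mumfordTateGroup (⨁ A).dim (⨁ A).X →* mumfordTateGroup (A i).dim (A i).X) e.toMonoidHom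
        (fun j ↦ j.elim0) i
    exact ⟨MonoidHom.pi c, fun g g' h ↦ e.injective (congrFun h 0)⟩
  | n + 1, A => by
    obtain ⟨ρT, hTinj⟩ := exists_mumfordTateGroup_biproduct_restrictHom (fun j : Fin (n + 1) ↦ A j.succ)
    obtain ⟨e⟩ := nonempty_mumfordTateGroup_mulEquiv_of_isIsogenous
      (⟨_, isIsogeny_biproductSuccSplit A⟩ : AbelianVariety.IsIsogenous (⨁ A) ((A 0).prod (⨁ fun j : Fin (n + 1) ↦ A j.succ)))
    obtain ⟨ρ₂, hρ₂⟩ := exists_mumfordTateGroup_prod_restrictHom (A 0) (⨁ fun j : Fin (n + 1) ↦ A j.succ)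
    let c₀ : mumfordTateGroup (⨁ A).dim (⨁ A).X →* mumfordTateGroup (A 0).dim (A 0).X := (MonoidHom.fst _ _).comp (ρ₂.comp e.toMonoidHom)
    let cs : ∀ j : Fin (n + 1), mumfordTateGroup (⨁ A).dim (⨁ A).X →* mumfordTateGroup (A j.succ).dim (A j.succ).X := fun j ↦
      (Pi.evalMonoidHom (fun j : Fin (n + 1) ↦ mumfordTateGroup (A j.succ).dim (A j.succ).X) j).comp
        (ρT.comp ((MonoidHom.snd _ _).comp (ρ₂.comp e.toMonoidHom)))
    let ρ : mumfordTateGroup (⨁ A).dim (⨁ A).X →* ∀ i, mumfordTateGroup (A i).dim (A i).X :=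
      MonoidHom.pi fun i ↦ Fin.cases (motive := fun i ↦ mumfordTateGroup (⨁ A).dim (⨁ A).X →* mumfordTateGroup (A i).dim (A i).X) c₀ cs i
    have hρ0 : ∀ g, ρ g 0 = (ρ₂ (e g)).1 := fun _ ↦ rfl
    have hρs : ∀ g (j : Fin (n + 1)), ρ g j.succ = ρT (ρ₂ (e g)).2 j := fun _ _ ↦ rfl
    refine ⟨ρ, fun g g' hgg ↦ e.injective (mumfordTateGroup_prod_restrictHom_injective hρ₂ (Prod.ext ?_ (hTinj (funext fun j ↦ ?_))))⟩
    · rw [← hρ0, ← hρ0, hgg]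
    · rw [← hρs, ← hρs, hgg]

variable {n : ℕ} {X : AbelianVariety ℂ}

/-- **`MT(X)(ℂ) ↪ ∏ᵢ MT(Aᵢ)(ℂ)` FOR EVERY `X ∼ ⨁ᵢ Aᵢ^{rᵢ+1}`** (no hypothesis on the factors): isogeny invariance,
`MT(⨁ᵢ Aᵢ^{rᵢ+1}) ≅ MT(⨁ᵢ Aᵢ)` (the lane's `nonempty_mumfordTateGroup_biproduct_mulEquiv_biproduct_powSucc`) and §3.
[cite: Gordon1999HodgeAVSurvey, 2.1.7 and 2.2] [cite: MoonenZarhin1999LowDim, §1 and §3 (3.1)] -/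
theorem exists_mumfordTateGroup_restrictHom_of_isIsogenous_biproduct_powSucc (A : Fin (n + 1) → AbelianVariety ℂ) (r : Fin (n + 1) → ℕ)
    (hX : AbelianVariety.IsIsogenous X (⨁ fun i ↦ (A i).powSucc (r i))) :
    ∃ ρ : mumfordTateGroup X.dim X.X →* ∀ i, mumfordTateGroup (A i).dim (A i).X, Function.Injective ρ := by
  obtain ⟨e₁⟩ := nonempty_mumfordTateGroup_mulEquiv_of_isIsogenous hX
  obtain ⟨e₂⟩ := nonempty_mumfordTateGroup_biproduct_mulEquiv_biproduct_powSucc A r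
  obtain ⟨ρ, hinj⟩ := exists_mumfordTateGroup_biproduct_restrictHom A
  exact ⟨ρ.comp (e₁.trans e₂.symm).toMonoidHom, hinj.comp (e₁.trans e₂.symm).injective⟩

/-- **`MT(X)(ℂ)` is commutative as soon as every `MT(Aᵢ)(ℂ)` is, for `X ∼ ⨁ᵢ Aᵢ^{rᵢ+1}`** (it embeds in `∏ᵢ MT(Aᵢ)(ℂ)`).
[cite: Gordon1999HodgeAVSurvey, 2.2 and 2.3 (iii)] -/
theorem forall_mul_comm_mumfordTateGroup_of_forall_of_isIsogenous_biproduct_powSucc (A : Fin (n + 1) → AbelianVariety ℂ)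
    (r : Fin (n + 1) → ℕ) (hX : AbelianVariety.IsIsogenous X (⨁ fun i ↦ (A i).powSucc (r i)))
    (hA : ∀ (i : Fin (n + 1)) (g h : mumfordTateGroup (A i).dim (A i).X), g * h = h * g) (g h : mumfordTateGroup X.dim X.X) :
    g * h = h * g := by
  obtain ⟨ρ, hinj⟩ := exists_mumfordTateGroup_restrictHom_of_isIsogenous_biproduct_powSucc A r hX
  exact hinj (by rw [map_mul, map_mul]; exact funext fun i ↦ hA i _ _)

end Finite

end Literature.AlgebraicGeometry.Milne1999
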